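/-
Copyright: the b2b-balaban T⁴-continuum CRUX team, row NE7b OWNER lineage `t4-ne7b-p1` (gen 125). Project licence.
-/
import Summits.QuantumFields.BalabanUV.T4Continuum.Spine.NE7b.SupZdGreenIdentity
import Summits.QuantumFields.BalabanUV.T4Continuum.Spine.NE7b.SupZdKernelResponseLipschitz

/-!
# THE `H + K` COLUMN'S FLUCTUATION COVARIANCE IS SYMMETRIC (symmetric `K`), ON `ℤ^d`: for a potential `V`, a symmetric kernel
# `|K(p,q)| ≤ εe^{−γ|p−q|₁}`, two bounded sources `f, g` and ANY fluctuation parts `w_f = C_Kf`, `w_g = C_Kg` with (221)'s displays — block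
# profiles, `Q′w = 0`, `(H_V + K)w_f = f − c_f∘blk` with a coarse remainder of block profile (`c_f = Σ″m_f(b″)N(·,b″)`, §2) —:
# `Σ′_p(C_Kg)(p)f(p) = Σ′_p(C_Kf)(p)g(p)`, i.e. `⟨g, C_Kf⟩ = ⟨C_Kg, f⟩` — the covariance kernel of the perturbed road is SYMMETRIC; (231)'s Green
# identity for `H_V + K` between the two fluctuation parts, and the orthogonality `Σ′_pw(p)c(blk n p) = 0` of a mean-zero fine function against
# a block-constant one (§1, Fubini by blocks) (row NE7b, node U5c; (231)∕(245) BY NAME; [folklore])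

Cell `pub-balaban`, sub-cell `t4`, spine estimate NE7b (`T4WeightBudget.RelWeightBound`; the cell's OWN estimate — NOT PRINTED in
[Bałaban 1983–89], NOT PROVED).  Crux-route work under `Spine/NE7b/` by the row OWNER (`t4-ne7b-p1` gen 125, file (256)) under FREEZE
(0)'s crux-prover clause; NOTHING of Bałaban's is named as a Lean object, valued or asserted; no `T4Continuum/Support` leaf typed; no `def`,
no notation (the fluctuation parts and coarse remainders are ANY data with the displayed properties — (221)∕(222)∕(246) supply them, §2
supplies the remainder's profile); zero `sorry`.  Imports (BY NAME): the OWNER's (231) `…SupZdGreenIdentity` (`green_identity`,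
`blockAverage_symm`, `summable_of_blockProfile`), (245) `…SupZdKernelResponseLipschitz` (`conv_term_le`); (27) `mem_B`, `sum_B_const`, (191)
`natAbs_sub_comm_sum`; Mathlib's `Summable.tsum_add`.

WHY (located).  A covariance must be symmetric (and positive); for the road's `C_K = (H+K)⁻¹ − (H+K)⁻¹Q′*(Q′(H+K)⁻¹Q′*)⁻¹Q′(H+K)⁻¹` this is formal
when `H + K` is symmetric, but on `ℤ^d` the objects are pointwise kernels built by limits ((216)–(222)), so symmetry is a THEOREM about them:
`⟨C_Kg, f⟩ = ⟨C_Kg, (H+K)C_Kf⟩ + ⟨C_Kg, c_f∘blk⟩ = ⟨(H+K)C_Kg, C_Kf⟩ + 0 = ⟨g, C_Kf⟩ − ⟨c_g∘blk, C_Kf⟩ = ⟨g, C_Kf⟩` — Green ((231), symmetric `K`,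
both fluctuation parts have block profiles by (221) (i)) and `Q′C_K = 0` ((221) (ii)) against block-constant functions.  Positivity
`⟨f, C_Kf⟩ = ⟨(H+K)C_Kf, C_Kf⟩ ≥ 0` needs the form coercivity of `H_V + K` on `ℤ^d` for profile functions — recorded, not typed here.

WHAT IS PROVED ([folklore]): §1 **`fine_sum_blocks_zero`** (`w` of block profile with `Q′w = 0`, `c` of coarse profile ⟹ `Σ′_pw(p)c(blk n p) = 0`,
absolutely); §2 `coarse_remainder_profile` (`|Σ″m(b″)N(b,b″)| ≤ C_NC_mK_{μ−ν}e^{−ν|b−b₀|₁}` — the profile of (221) (iii)'s remainder, (245) §1);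
§3 THE END **`perturbed_covariance_symmetric`** (for ALL `n, a, V` bounded, symmetric `K` of the class, bounded `f, g`, ANY `w_f, w_g, c_f, c_g`
with the displays: both pairings converge absolutely and `Σ′w_gf = Σ′w_fg`); §4 toy.

HONEST (what this is NOT).  Symmetry only — NOT positivity (needs coercivity of `H_V + K` on profile functions on `ℤ^d`); profile (block-
localised) fluctuation parts only (bounded sources with bounded `C_Kf` are (253)'s, where Green needs decay of at least one side); scalar
skeleton ((A3), NC-NE7b-α UNRULED); nothing of the torus; nothing of the covariant propagators of [B4]–[B6]; nothing of Bałaban's asserted.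
BY-NAME EFFECT ON THE WALL: NONE.  NE7b NOT PRINTED ∕ NOT PROVED; spine PROVED 0∕9; rung (B)+1 — the programme's measures remain
FINITE-torus statements; NOT the mass gap, NOT Clay.  HONEST DEPENDENCY: continuum YM on T⁴ ⇐ BetaPertH ∧ nine spine estimates (0∕9
proved); BetaPertH ⇐ (D1) ∧ (D4) ∧ CAP+tail; G-an2-4 gates asym, D1 and NE2∕3∕4.
-/

set_option autoImplicit false

noncomputable section

namespace Summit.QuantumFields.BalabanUV.T4Continuum.NE7b.SupZdPerturbedCovarianceSymmetric

open Real Filter Topology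
open Literature.MathematicalPhysics.QuantumFieldTheory.Balaban1983to89
open B6QGQLower276 (X e blk B mem_B sum_B_const)
open SupZdCoarseForm (natAbs_sub_comm_sum)
open SupZdGreenIdentity (green_identity blockAverage_symm summable_of_blockProfile)
open SupZdKernelResponseLipschitz (conv_term_le)

variable {d : ℕ}

/-! ## §1. A mean-zero fine function is orthogonal to block-constant functions -/

/-- **`Q′w = 0` ⟹ `Σ′_pw(p)c(blk n p) = 0`**: `w` of block profile `Ae^{−μ|blk n p − b_w|₁}` with vanishing block means and `c` of coarse profile
`C_ce^{−μ|b − b_c|₁}` ⟹ the pairing converges absolutely and vanishes — (231)'s block Fubini with the block-constant `(n+1)^{−d}c∘blk`, whose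
block sums are `c`, against `w`, whose block sums are `0`. [folklore] -/
theorem fine_sum_blocks_zero (n : ℕ) {μ A Cc : ℝ} (hμ : 0 < μ) (bw bc : X d) (w c : X d → ℝ)
    (hw : ∀ p, |w p| ≤ A * exp (-(μ * ∑ i, (((blk n p i - bw i).natAbs : ℕ) : ℝ))))
    (hc : ∀ b, |c b| ≤ Cc * exp (-(μ * ∑ i, (((b i - bc i).natAbs : ℕ) : ℝ))))
    (hQ : ∀ b, (((n : ℝ) + 1) ^ d)⁻¹ * ∑ q ∈ B n b, w q = 0) :
    Summable (fun p => w p * c (blk n p)) ∧ ∑' p : X d, w p * c (blk n p) = 0 := by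
  classical
  have hvol : (0 : ℝ) < ((n : ℝ) + 1) ^ d := by positivity
  obtain ⟨W, hW⟩ : ∃ W : X d → ℝ, ∀ q, W q = (((n : ℝ) + 1) ^ d)⁻¹ * c (blk n q) := ⟨_, fun _ => rfl⟩
  have hWB : ∀ q, |W q| ≤ (((n : ℝ) + 1) ^ d)⁻¹ * Cc * exp (-(μ * ∑ i, (((blk n q i - bc i).natAbs : ℕ) : ℝ))) := fun q => by
    rw [hW, abs_mul, abs_of_pos (inv_pos.2 hvol), mul_assoc]
    exact mul_le_mul_of_nonneg_left (hc (blk n q)) (inv_pos.2 hvol).le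
  have hWsum : ∀ b, ∑ q ∈ B n b, W q = c b := by
    intro b
    rw [Finset.sum_congr rfl fun q hq => by rw [hW, mem_B.1 hq], sum_B_const, ← mul_assoc, mul_inv_cancel₀ hvol.ne', one_mul]
  have hzero : ∀ b, ∑ q ∈ B n b, w q = 0 := fun b => by
    have h := hQ b
    rcases mul_eq_zero.1 h with h1 | h1
    · exact absurd h1 (inv_ne_zero hvol.ne')
    · exact h1
  obtain ⟨hs, he⟩ := blockAverage_symm n hμ bw bc w W hw hWB
  simp only [hWsum] at hs he
  refine ⟨hs, ?_⟩
  rw [he]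
  simp only [hzero, mul_zero, tsum_zero]

/-! ## §2. The coarse remainder has a profile -/

/-- **THE PROFILE OF (221) (iii)'s REMAINDER**: `|m(b″)| ≤ C_me^{−μ|b″−b₀|₁}`, `|N(b,b″)| ≤ C_Ne^{−ν|b−b″|₁}`, `0 < ν < μ` ⟹ `Σ″m(b″)N(b,b″)` converges
absolutely and `|Σ″m(b″)N(b,b″)| ≤ C_NC_mK_{μ−ν}e^{−ν|b−b₀|₁}` — (245)'s no-loss convolution. [folklore] -/
theorem coarse_remainder_profile {Cm μ CN ν : ℝ} (hν : 0 < ν) (hνμ : ν < μ) (m : X d → ℝ) (N : X d → X d → ℝ) (b₀ b : X d)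
    (hm : ∀ b'', |m b''| ≤ Cm * exp (-(μ * ∑ i, (((b'' i - b₀ i).natAbs : ℕ) : ℝ))))
    (hN : ∀ b'', |N b b''| ≤ CN * exp (-(ν * ∑ i, (((b i - b'' i).natAbs : ℕ) : ℝ)))) :
    Summable (fun b'' : X d => m b'' * N b b'') ∧
    |∑' b'' : X d, m b'' * N b b''| ≤ CN * Cm * (2 * (1 - exp (-(μ - ν)))⁻¹) ^ d * exp (-(ν * ∑ i, (((b i - b₀ i).natAbs : ℕ) : ℝ))) := by
  have hN' : ∀ b'', |N b b''| ≤ CN * exp (-(ν * ∑ i, (((b'' i - b i).natAbs : ℕ) : ℝ))) := fun b'' => by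
    rw [natAbs_sub_comm_sum b'' b]; exact hN b''
  have hm' : ∀ b'', |m b''| ≤ Cm * exp (-(μ * ∑ i, (((b₀ i - b'' i).natAbs : ℕ) : ℝ))) := fun b'' => by
    rw [natAbs_sub_comm_sum b₀ b'']; exact hm b''
  obtain ⟨hs, hb⟩ := conv_term_le hν.le hνμ b b₀ (fun b'' => N b b'') m hN' hm'
  rw [natAbs_sub_comm_sum b₀ b] at hb
  exact ⟨hs.congr fun b'' => mul_comm _ _, by rw [tsum_congr fun b'' => mul_comm (m b'') (N b b'')]; exact hb⟩

/-! ## §3. THE END: the covariance pairing is symmetric -/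

/-- **HEADLINE — `⟨C_Kg, f⟩ = ⟨C_Kf, g⟩`**: for every mesh `n`, coupling `a`, bounded potential `V`, symmetric kernel `|K(p,q)| ≤ εe^{−γ|p−q|₁}`,
bounded sources `f, g`, and ANY `w_f, w_g` (block profiles at rate `μ` about `b_f, b_g`), `c_f, c_g` (coarse profiles at rate `ν ≤ μ`) with
`Q′w_f = 0 = Q′w_g`, `(H_V + K)w_f = f − c_f∘blk`, `(H_V + K)w_g = g − c_g∘blk` ((221)'s displays of `C_Kf`, `C_Kg`): both pairings converge absolutely
and `Σ′_pw_g(p)f(p) = Σ′_pw_f(p)g(p)` — Green ((231)) + §1 twice. [folklore] -/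
theorem perturbed_covariance_symmetric (n : ℕ) (a : ℝ) {μ ν ε γ BV Af Ag Cf Cg Bf Bg : ℝ} (hμ : 0 < μ) (hν : 0 < ν) (hνμ : ν ≤ μ)
    (hε : 0 ≤ ε) (hγ : 0 < γ) (V : X d → ℝ) (hVb : ∀ p, |V p| ≤ BV)
    (K : X d → X d → ℝ) (hK : ∀ p q, |K p q| ≤ ε * exp (-(γ * ∑ i, (((p i - q i).natAbs : ℕ) : ℝ)))) (hKs : ∀ p q, K p q = K q p)
    (bf bg : X d) (f g wf wg cf cg : X d → ℝ) (hfB : ∀ p, |f p| ≤ Bf) (hgB : ∀ p, |g p| ≤ Bg)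
    (hwf : ∀ p, |wf p| ≤ Af * exp (-(μ * ∑ i, (((blk n p i - bf i).natAbs : ℕ) : ℝ))))
    (hwg : ∀ p, |wg p| ≤ Ag * exp (-(μ * ∑ i, (((blk n p i - bg i).natAbs : ℕ) : ℝ))))
    (hcf : ∀ b, |cf b| ≤ Cf * exp (-(ν * ∑ i, (((b i - bf i).natAbs : ℕ) : ℝ))))
    (hcg : ∀ b, |cg b| ≤ Cg * exp (-(ν * ∑ i, (((b i - bg i).natAbs : ℕ) : ℝ))))
    (hQf : ∀ b, (((n : ℝ) + 1) ^ d)⁻¹ * ∑ q ∈ B n b, wf q = 0) (hQg : ∀ b, (((n : ℝ) + 1) ^ d)⁻¹ * ∑ q ∈ B n b, wg q = 0)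
    (hHf : ∀ p, ((n : ℝ) + 1) ^ 2 * ∑ ν', (2 * wf p - wf (p + e ν') - wf (p - e ν'))
      + a / ((n : ℝ) + 1) ^ d * ∑ q ∈ B n (blk n p), wf q + V p * wf p + ∑' q : X d, K p q * wf q = f p - cf (blk n p))
    (hHg : ∀ p, ((n : ℝ) + 1) ^ 2 * ∑ ν', (2 * wg p - wg (p + e ν') - wg (p - e ν'))
      + a / ((n : ℝ) + 1) ^ d * ∑ q ∈ B n (blk n p), wg q + V p * wg p + ∑' q : X d, K p q * wg q = g p - cg (blk n p)) :
    Summable (fun p => wg p * f p) ∧ Summable (fun p => wf p * g p) ∧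
    ∑' p : X d, wg p * f p = ∑' p : X d, wf p * g p := by
  classical
  have hS0 : ∀ b c : X d, (0 : ℝ) ≤ ∑ i, (((b i - c i).natAbs : ℕ) : ℝ) := fun b c => by positivity
  have hAf : 0 ≤ Af := by
    have h := (abs_nonneg _).trans (hwf 0); exact le_of_mul_le_mul_right (by rw [zero_mul]; exact h) (exp_pos _)
  have hAg : 0 ≤ Ag := by
    have h := (abs_nonneg _).trans (hwg 0); exact le_of_mul_le_mul_right (by rw [zero_mul]; exact h) (exp_pos _)
  -- the profiles at the weaker rate `ν`
  have hwfν : ∀ p, |wf p| ≤ Af * exp (-(ν * ∑ i, (((blk n p i - bf i).natAbs : ℕ) : ℝ))) := fun p =>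
    (hwf p).trans (mul_le_mul_of_nonneg_left (exp_le_exp.2 (neg_le_neg (mul_le_mul_of_nonneg_right hνμ (hS0 _ _)))) hAf)
  have hwgν : ∀ p, |wg p| ≤ Ag * exp (-(ν * ∑ i, (((blk n p i - bg i).natAbs : ℕ) : ℝ))) := fun p =>
    (hwg p).trans (mul_le_mul_of_nonneg_left (exp_le_exp.2 (neg_le_neg (mul_le_mul_of_nonneg_right hνμ (hS0 _ _)))) hAg)
  -- absolute convergence of the two pairings
  have swf : Summable wf := summable_of_blockProfile n hμ bf wf hwf
  have swg : Summable wg := summable_of_blockProfile n hμ bg wg hwg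
  have s1 : Summable fun p => wg p * f p := Summable.of_norm_bounded (swg.abs.mul_right Bf) fun p => by
    rw [Real.norm_eq_abs, abs_mul]; exact mul_le_mul_of_nonneg_left (hfB p) (abs_nonneg _)
  have s2 : Summable fun p => wf p * g p := Summable.of_norm_bounded (swf.abs.mul_right Bg) fun p => by
    rw [Real.norm_eq_abs, abs_mul]; exact mul_le_mul_of_nonneg_left (hgB p) (abs_nonneg _)
  refine ⟨s1, s2, ?_⟩
  -- Green between the two fluctuation parts
  obtain ⟨hGs, hGe⟩ := green_identity n a hμ hε hγ bg bf wg wf hwg hwf V hVb K hK hKs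
  simp only [hHf, hHg] at hGs hGe
  -- the block-constant remainders pair to zero
  obtain ⟨z1s, z1⟩ := fine_sum_blocks_zero n hν bg bf wg cf hwgν hcf hQg
  obtain ⟨z2s, z2⟩ := fine_sum_blocks_zero n hν bf bg wf cg hwfν hcg hQf
  have e1 : ∑' p : X d, wg p * f p = ∑' p : X d, wg p * (f p - cf (blk n p)) + ∑' p : X d, wg p * cf (blk n p) := by
    rw [← hGs.tsum_add z1s]; exact tsum_congr fun p => by ring
  have hGs' : Summable fun p => wf p * (g p - cg (blk n p)) := by
    have h := s2.sub z2s
    exact h.congr fun p => by ring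
  have e2 : ∑' p : X d, wf p * g p = ∑' p : X d, wf p * (g p - cg (blk n p)) + ∑' p : X d, wf p * cg (blk n p) := by
    rw [← hGs'.tsum_add z2s]; exact tsum_congr fun p => by ring
  rw [e1, e2, z1, z2, hGe]

/-! ## §4. Toy -/

/-- Toy (`d = 1`, `n = 0`): a mean-zero fine function against a block-constant one — with everything zero both conclusions of §1 hold. -/
example : ∑' p : X 1, (fun _ => (0 : ℝ)) p * (fun _ => (0 : ℝ)) (blk 0 p) = 0 :=
  (fine_sum_blocks_zero (d := 1) 0 (μ := 1) (A := 0) (Cc := 0) one_pos 0 0 (fun _ => 0) (fun _ => 0)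
    (fun _ => by simp) (fun _ => by simp) (fun _ => by simp)).2

end Summit.QuantumFields.BalabanUV.T4Continuum.NE7b.SupZdPerturbedCovarianceSymmetric
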